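import Mathlib
import Summits.AtomisticToContinuum.Crystallization.Theorems.SquareWellLayerCakeStackingFaultSparsityExactLatticeLedgerFar

/-!
# Exact-lattice ledger, IV: SAME-layer pairs and the rim across the wall (helper file)

Crux `StackingFaultSparsity` (item stmt-AtomisticToContinuum-14296, routes `SquareWellLayerCake` /
`LaminarSixThreeThree`), line `Sketch`, stub `stub_exactLatticeLedger` (survey obligation M3c+e, the
exact-lattice ledger of the cylinder block flip; landing file
`SquareWellLayerCakeStackingFaultSparsityExactLatticeLedger.lean`, whose module docstring has the
overall map).

`ledger_same_site`, `ledger_same` (carrier; `|∑_SAME Δ| ≤ C_S ρ (q₂ - q₁)`), `ledger_up_rim_site`,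
`ledger_up_rim_out` (lower sites outside the lateral disc: `∑ |UP| ≤ C₁ ρ (q₂ - q₁)`) — all from the
rim shell sum `rim_sum_le` and the depth summation `ledger_depth_sum`.
-/

noncomputable section
namespace Summit.AtomisticToContinuum.Crystallization.Theorems.SquareWellLayerCake.StackingFaultSparsity
open Literature.MathematicalPhysics.StatisticalMechanics

/-! ## 4. SAME-layer pairs (L4, rim within a layer) -/

/-- **Rim partners of a disc point within its layer (L4).** There is `A ≥ 0` such that for
every cylinder point `q` the non-disc points `q'` of its own layer in the window contribute
`∑ |Δ q q'| ≤ A max(t - 1, 1/2)⁻³`, `t = ρ - √latSq(q)` the depth of `q` below the rim: such a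
`q'` is at lateral distance `> t` from `q`, the new position `q + σ w` (`‖w‖ ≤ 3/5`) is still at
lateral distance `≥ t - 3/5` from `q'`, the partners are `1/2`-separated (`half_le_dist_old`), and
`|V| ≤ 6 r⁻⁶` sums to `≤ C max(t - 1, 1/2)⁻³` by the two-scale shell sum. [folklore] -/
theorem ledger_same_site : ∃ A : ℝ, 0 ≤ A ∧ ∀ K : ℕ, 2 ≤ K →
    ∀ (a h : ℝ) (s : ℤ → ℤ) (q₁ q₂ i₀ j₀ : ℤ) (ρ R : ℝ) (I : Finset (ℤ × ℤ × ℤ))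
      (D : ℤ × ℤ × ℤ → (EuclideanSpace ℝ (Fin 3))) (Δ : ℤ × ℤ × ℤ → ℤ × ℤ × ℤ → ℝ),
      InBox a h → IsHaggSeq s → q₁ < q₂ → (3 : ℤ) ∣ haggLabel s q₂ - haggLabel s q₁ → 1 ≤ ρ →
      ρ + ((q₂ : ℝ) - q₁) * h + K * h + 1 ≤ R →
      (∀ q, InCyl a h s q₁ q₂ i₀ j₀ ρ q.1 q.2.1 q.2.2 →
        D q = ((shiftSign s q₁ q.1 : ℤ) : ℝ) • barlowOffset a) →
      (∀ q, ¬ InCyl a h s q₁ q₂ i₀ j₀ ρ q.1 q.2.1 q.2.2 → D q = 0) →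
      (∀ q q', Δ q q' =
        lennardJones (dist (barlowPos a h s q.1 q.2.1 q.2.2 + D q)
            (barlowPos a h s q'.1 q'.2.1 q'.2.2 + D q')) -
          lennardJones (dist (barlowPos a h s q.1 q.2.1 q.2.2)
            (barlowPos a h s q'.1 q'.2.1 q'.2.2))) →
      (∀ q, q ∈ I ↔ dist (barlowPos a h s q.1 q.2.1 q.2.2) (barlowPos a h s q₁ i₀ j₀) ≤ R) →
      ∀ q ∈ I, (q₁ < q.1 ∧ q.1 < q₂ ∧ latSq (barlowPos a h s q.1 q.2.1 q.2.2) (barlowPos a h s q₁ i₀ j₀) ≤ ρ ^ 2) →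
        ∑ q' ∈ I.filter (fun q' => q'.1 = q.1 ∧ ¬ (latSq (barlowPos a h s q'.1 q'.2.1 q'.2.2) (barlowPos a h s q₁ i₀ j₀) ≤ ρ ^ 2)), |Δ q q'| ≤
          A * (max (ρ - √(latSq (barlowPos a h s q.1 q.2.1 q.2.2) (barlowPos a h s q₁ i₀ j₀)) - 1)
            (1 / 2))⁻¹ ^ 3 := by
  refine ⟨66000, by norm_num, ?_⟩
  intro K hK a h s q₁ q₂ i₀ j₀ ρ R I D Δ hbox hs hq hcharge hρ hR hD₁ hD₀ hΔ hI q hqI hcyl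
  classical
  have hρ0 : 0 ≤ ρ := by linarith
  have hcore := rim_sum_le K hK a h s q₁ q₂ i₀ j₀ ρ R I D Δ hbox hs hq hcharge hρ hR hD₁ hD₀ hΔ hI q
    (I.filter (fun q' => q'.1 = q.1 ∧ ¬ (latSq (barlowPos a h s q'.1 q'.2.1 q'.2.2) (barlowPos a h s q₁ i₀ j₀) ≤ ρ ^ 2)))
    (ρ - √(latSq (barlowPos a h s q.1 q.2.1 q.2.2) (barlowPos a h s q₁ i₀ j₀)))
    (fun h0 => (Finset.mem_filter.1 h0).2.2 hcyl.2.2) ?_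
  · refine le_trans (Finset.sum_le_sum fun q' _ => ?_) hcore
    rw [hΔ]
    exact abs_sub _ _
  · intro q' hq'
    rw [Finset.mem_filter] at hq'
    have h1 : ρ < √(latSq (barlowPos a h s q'.1 q'.2.1 q'.2.2) (barlowPos a h s q₁ i₀ j₀)) := by
      rw [← Real.sqrt_sq hρ0]
      exact Real.sqrt_lt_sqrt (sq_nonneg ρ) (not_le.1 hq'.2.2)
    have h2 := sqrt_latSq_triangle (barlowPos a h s q'.1 q'.2.1 q'.2.2) (barlowPos a h s q.1 q.2.1 q.2.2)
      (barlowPos a h s q₁ i₀ j₀)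
    rw [latSq_comm (barlowPos a h s q'.1 q'.2.1 q'.2.2) (barlowPos a h s q.1 q.2.1 q.2.2)] at h2
    linarith

/-- **SAME-layer pairs** (assembly of `ledger_same_site` and `ledger_depth_sum`): `|∑_SAME Δ| ≤
C_S ρ (q₂ - q₁)`, `C_S = 1352 A`.  Within a layer only the pairs (disc point, non-disc point) of a
moved layer `q₁ < n < q₂` change (two disc points of one layer move by the same `σ_n • w`); by
symmetry the double sum is twice the sum over (disc, non-disc), which is summed by depth.
[folklore] -/
theorem ledger_same : ∃ C_S : ℝ, 0 ≤ C_S ∧ ∀ K : ℕ, 2 ≤ K →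
    ∀ (a h : ℝ) (s : ℤ → ℤ) (q₁ q₂ i₀ j₀ : ℤ) (ρ R : ℝ) (I : Finset (ℤ × ℤ × ℤ))
      (D : ℤ × ℤ × ℤ → (EuclideanSpace ℝ (Fin 3))) (Δ : ℤ × ℤ × ℤ → ℤ × ℤ × ℤ → ℝ),
      InBox a h → IsHaggSeq s → q₁ < q₂ → (3 : ℤ) ∣ haggLabel s q₂ - haggLabel s q₁ → 1 ≤ ρ →
      ρ + ((q₂ : ℝ) - q₁) * h + K * h + 1 ≤ R →
      (∀ q, InCyl a h s q₁ q₂ i₀ j₀ ρ q.1 q.2.1 q.2.2 →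
        D q = ((shiftSign s q₁ q.1 : ℤ) : ℝ) • barlowOffset a) →
      (∀ q, ¬ InCyl a h s q₁ q₂ i₀ j₀ ρ q.1 q.2.1 q.2.2 → D q = 0) →
      (∀ q q', Δ q q' =
        lennardJones (dist (barlowPos a h s q.1 q.2.1 q.2.2 + D q)
            (barlowPos a h s q'.1 q'.2.1 q'.2.2 + D q')) -
          lennardJones (dist (barlowPos a h s q.1 q.2.1 q.2.2)
            (barlowPos a h s q'.1 q'.2.1 q'.2.2))) →
      (∀ q, q ∈ I ↔ dist (barlowPos a h s q.1 q.2.1 q.2.2) (barlowPos a h s q₁ i₀ j₀) ≤ R) →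
      |∑ q ∈ I, ∑ q' ∈ I.filter (fun q' => q'.1 = q.1), Δ q q'| ≤ C_S * ρ * ((q₂ : ℝ) - q₁) := by
  obtain ⟨A, hA0, hsite⟩ := ledger_same_site
  refine ⟨1352 * A, by positivity, ?_⟩
  intro K hK a h s q₁ q₂ i₀ j₀ ρ R I D Δ hbox hs hq hcharge hρ hR hD₁ hD₀ hΔ hI
  classical
  have hS := hsite K hK a h s q₁ q₂ i₀ j₀ ρ R I D Δ hbox hs hq hcharge hρ hR hD₁ hD₀ hΔ hI
  have hsymm : ∀ q q', Δ q q' = Δ q' q := pairChange_symm hΔ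
  have ha : 47 / 50 ≤ a := hbox.1
  -- pointwise sorting of a same-layer pair
  have hpt : ∀ q q' : ℤ × ℤ × ℤ, (if q'.1 = q.1 then Δ q q' else 0) =
      (if q'.1 = q.1 ∧ (q₁ < q.1 ∧ q.1 < q₂) ∧ (latSq (barlowPos a h s q.1 q.2.1 q.2.2) (barlowPos a h s q₁ i₀ j₀) ≤ ρ ^ 2) ∧ ¬ (latSq (barlowPos a h s q'.1 q'.2.1 q'.2.2) (barlowPos a h s q₁ i₀ j₀) ≤ ρ ^ 2)
        then Δ q q' else 0) +
      (if q.1 = q'.1 ∧ (q₁ < q'.1 ∧ q'.1 < q₂) ∧ (latSq (barlowPos a h s q'.1 q'.2.1 q'.2.2) (barlowPos a h s q₁ i₀ j₀) ≤ ρ ^ 2) ∧ ¬ (latSq (barlowPos a h s q.1 q.2.1 q.2.2) (barlowPos a h s q₁ i₀ j₀) ≤ ρ ^ 2)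
        then Δ q' q else 0) := by
    intro q q'
    by_cases hsame : q'.1 = q.1
    · rw [if_pos hsame]
      by_cases hmid : q₁ < q.1 ∧ q.1 < q₂
      · have hmid' : q₁ < q'.1 ∧ q'.1 < q₂ := by rw [hsame]; exact hmid
        by_cases hd : (latSq (barlowPos a h s q.1 q.2.1 q.2.2) (barlowPos a h s q₁ i₀ j₀) ≤ ρ ^ 2)
        · by_cases hd' : (latSq (barlowPos a h s q'.1 q'.2.1 q'.2.2) (barlowPos a h s q₁ i₀ j₀) ≤ ρ ^ 2)
          · -- both disc points of a moved layer: same displacement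
            have h0 : Δ q q' = 0 := by
              refine pairChange_eq_zero_of_disp_eq hΔ ?_
              rw [hD₁ q ⟨hmid.1, hmid.2, hd⟩, hD₁ q' ⟨hmid'.1, hmid'.2, hd'⟩, hsame]
            rw [if_neg (fun h1 => h1.2.2.2 hd'), if_neg (fun h1 => h1.2.2.2 hd), h0, add_zero]
          · rw [if_pos ⟨hsame, hmid, hd, hd'⟩, if_neg (fun h1 => h1.2.2.2 hd), add_zero]
        · by_cases hd' : (latSq (barlowPos a h s q'.1 q'.2.1 q'.2.2) (barlowPos a h s q₁ i₀ j₀) ≤ ρ ^ 2)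
          · rw [if_neg (fun h1 => hd h1.2.2.1), if_pos ⟨hsame.symm, hmid', hd', hd⟩, zero_add,
              hsymm q q']
          · have h0 : Δ q q' = 0 := by
              refine pairChange_eq_zero_of_disp_eq hΔ ?_
              rw [hD₀ q (fun hc => hd hc.2.2), hD₀ q' (fun hc => hd' hc.2.2)]
            rw [if_neg (fun h1 => hd h1.2.2.1), if_neg (fun h1 => hd' h1.2.2.1), h0, add_zero]
      · have hmid' : ¬ (q₁ < q'.1 ∧ q'.1 < q₂) := by rw [hsame]; exact hmid
        have h0 : Δ q q' = 0 := by
          refine pairChange_eq_zero_of_disp_eq hΔ ?_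
          rw [hD₀ q (fun hc => hmid ⟨hc.1, hc.2.1⟩), hD₀ q' (fun hc => hmid' ⟨hc.1, hc.2.1⟩)]
        rw [if_neg (fun h1 => hmid h1.2.1), if_neg (fun h1 => hmid' h1.2.1), h0, add_zero]
    · rw [if_neg hsame, if_neg (fun h1 => hsame h1.1), if_neg (fun h1 => hsame h1.1.symm), add_zero]
  -- the double sum is twice the (disc, non-disc) sum
  have step1 : ∑ q ∈ I, ∑ q' ∈ I.filter (fun q' => q'.1 = q.1), Δ q q' =
      2 * ∑ q ∈ I, ∑ q' ∈ I,
        (if q'.1 = q.1 ∧ (q₁ < q.1 ∧ q.1 < q₂) ∧ (latSq (barlowPos a h s q.1 q.2.1 q.2.2) (barlowPos a h s q₁ i₀ j₀) ≤ ρ ^ 2) ∧ ¬ (latSq (barlowPos a h s q'.1 q'.2.1 q'.2.2) (barlowPos a h s q₁ i₀ j₀) ≤ ρ ^ 2)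
          then Δ q q' else 0) := by
    calc ∑ q ∈ I, ∑ q' ∈ I.filter (fun q' => q'.1 = q.1), Δ q q'
        = ∑ q ∈ I, ∑ q' ∈ I, (if q'.1 = q.1 then Δ q q' else 0) := by
          simp only [Finset.sum_filter]
      _ = ∑ q ∈ I, ∑ q' ∈ I,
          ((if q'.1 = q.1 ∧ (q₁ < q.1 ∧ q.1 < q₂) ∧ (latSq (barlowPos a h s q.1 q.2.1 q.2.2) (barlowPos a h s q₁ i₀ j₀) ≤ ρ ^ 2) ∧ ¬ (latSq (barlowPos a h s q'.1 q'.2.1 q'.2.2) (barlowPos a h s q₁ i₀ j₀) ≤ ρ ^ 2)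
              then Δ q q' else 0) +
           (if q.1 = q'.1 ∧ (q₁ < q'.1 ∧ q'.1 < q₂) ∧ (latSq (barlowPos a h s q'.1 q'.2.1 q'.2.2) (barlowPos a h s q₁ i₀ j₀) ≤ ρ ^ 2) ∧ ¬ (latSq (barlowPos a h s q.1 q.2.1 q.2.2) (barlowPos a h s q₁ i₀ j₀) ≤ ρ ^ 2)
              then Δ q' q else 0)) :=
          Finset.sum_congr rfl fun q _ => Finset.sum_congr rfl fun q' _ => hpt q q'
      _ = ∑ q ∈ I, ∑ q' ∈ I,
            (if q'.1 = q.1 ∧ (q₁ < q.1 ∧ q.1 < q₂) ∧ (latSq (barlowPos a h s q.1 q.2.1 q.2.2) (barlowPos a h s q₁ i₀ j₀) ≤ ρ ^ 2) ∧ ¬ (latSq (barlowPos a h s q'.1 q'.2.1 q'.2.2) (barlowPos a h s q₁ i₀ j₀) ≤ ρ ^ 2)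
              then Δ q q' else 0) +
          ∑ q ∈ I, ∑ q' ∈ I,
            (if q.1 = q'.1 ∧ (q₁ < q'.1 ∧ q'.1 < q₂) ∧ (latSq (barlowPos a h s q'.1 q'.2.1 q'.2.2) (barlowPos a h s q₁ i₀ j₀) ≤ ρ ^ 2) ∧ ¬ (latSq (barlowPos a h s q.1 q.2.1 q.2.2) (barlowPos a h s q₁ i₀ j₀) ≤ ρ ^ 2)
              then Δ q' q else 0) := by
          rw [← Finset.sum_add_distrib]
          exact Finset.sum_congr rfl fun q _ => Finset.sum_add_distrib
      _ = 2 * ∑ q ∈ I, ∑ q' ∈ I,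
            (if q'.1 = q.1 ∧ (q₁ < q.1 ∧ q.1 < q₂) ∧ (latSq (barlowPos a h s q.1 q.2.1 q.2.2) (barlowPos a h s q₁ i₀ j₀) ≤ ρ ^ 2) ∧ ¬ (latSq (barlowPos a h s q'.1 q'.2.1 q'.2.2) (barlowPos a h s q₁ i₀ j₀) ≤ ρ ^ 2)
              then Δ q q' else 0) := by
          rw [Finset.sum_comm (f := fun q q' =>
            (if q.1 = q'.1 ∧ (q₁ < q'.1 ∧ q'.1 < q₂) ∧ (latSq (barlowPos a h s q'.1 q'.2.1 q'.2.2) (barlowPos a h s q₁ i₀ j₀) ≤ ρ ^ 2) ∧ ¬ (latSq (barlowPos a h s q.1 q.2.1 q.2.2) (barlowPos a h s q₁ i₀ j₀) ≤ ρ ^ 2)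
              then Δ q' q else 0))]
          ring
  -- as a sum over the disc points of the moved layers
  have step2 : ∑ q ∈ I, ∑ q' ∈ I,
        (if q'.1 = q.1 ∧ (q₁ < q.1 ∧ q.1 < q₂) ∧ (latSq (barlowPos a h s q.1 q.2.1 q.2.2) (barlowPos a h s q₁ i₀ j₀) ≤ ρ ^ 2) ∧ ¬ (latSq (barlowPos a h s q'.1 q'.2.1 q'.2.2) (barlowPos a h s q₁ i₀ j₀) ≤ ρ ^ 2)
          then Δ q q' else 0) =
      ∑ q ∈ I.filter (fun q => (q₁ < q.1 ∧ q.1 < q₂) ∧ (latSq (barlowPos a h s q.1 q.2.1 q.2.2) (barlowPos a h s q₁ i₀ j₀) ≤ ρ ^ 2)),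
        ∑ q' ∈ I.filter (fun q' => q'.1 = q.1 ∧ ¬ (latSq (barlowPos a h s q'.1 q'.2.1 q'.2.2) (barlowPos a h s q₁ i₀ j₀) ≤ ρ ^ 2)), Δ q q' := by
    rw [Finset.sum_filter]
    refine Finset.sum_congr rfl fun q _ => ?_
    rw [Finset.sum_filter]
    split_ifs with hc
    · refine Finset.sum_congr rfl fun q' _ => ?_
      by_cases h1 : q'.1 = q.1 ∧ ¬ (latSq (barlowPos a h s q'.1 q'.2.1 q'.2.2) (barlowPos a h s q₁ i₀ j₀) ≤ ρ ^ 2)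
      · rw [if_pos h1, if_pos ⟨h1.1, hc.1, hc.2, h1.2⟩]
      · rw [if_neg h1, if_neg (fun h2 => h1 ⟨h2.1, h2.2.2.2⟩)]
    · exact Finset.sum_eq_zero fun q' _ => if_neg (fun h2 => hc ⟨h2.2.1, h2.2.2.1⟩)
  -- bound the (disc, non-disc) sum layer by layer
  have step3 : |∑ q ∈ I.filter (fun q => (q₁ < q.1 ∧ q.1 < q₂) ∧ (latSq (barlowPos a h s q.1 q.2.1 q.2.2) (barlowPos a h s q₁ i₀ j₀) ≤ ρ ^ 2)),
        ∑ q' ∈ I.filter (fun q' => q'.1 = q.1 ∧ ¬ (latSq (barlowPos a h s q'.1 q'.2.1 q'.2.2) (barlowPos a h s q₁ i₀ j₀) ≤ ρ ^ 2)), Δ q q'| ≤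
      (((q₂ : ℝ) - q₁) * (676 * A * ρ)) := by
    refine (Finset.abs_sum_le_sum_abs _ _).trans ?_
    have hmaps : ∀ q ∈ I.filter (fun q => (q₁ < q.1 ∧ q.1 < q₂) ∧ (latSq (barlowPos a h s q.1 q.2.1 q.2.2) (barlowPos a h s q₁ i₀ j₀) ≤ ρ ^ 2)),
        q.1 ∈ Finset.Ioo q₁ q₂ := by
      intro q hq'
      rw [Finset.mem_filter] at hq'
      exact Finset.mem_Ioo.2 hq'.2.1
    rw [← Finset.sum_fiberwise_of_maps_to hmaps]
    have hlayer : ∀ n ∈ Finset.Ioo q₁ q₂,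
        ∑ q ∈ (I.filter (fun q => (q₁ < q.1 ∧ q.1 < q₂) ∧ (latSq (barlowPos a h s q.1 q.2.1 q.2.2) (barlowPos a h s q₁ i₀ j₀) ≤ ρ ^ 2))).filter (fun q => q.1 = n),
          |∑ q' ∈ I.filter (fun q' => q'.1 = q.1 ∧ ¬ (latSq (barlowPos a h s q'.1 q'.2.1 q'.2.2) (barlowPos a h s q₁ i₀ j₀) ≤ ρ ^ 2)), Δ q q'| ≤
          26 * (8 * 1 + 18) * A * ρ := by
      intro n hn
      refine ledger_depth_sum a h s q₁ i₀ j₀ ρ n 1 A _ _ ha hρ zero_le_one hA0 ?_ ?_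
      · intro q hq'
        simp only [Finset.mem_filter] at hq'
        exact ⟨hq'.2, hq'.1.2.2⟩
      · intro q hq'
        simp only [Finset.mem_filter] at hq'
        refine (Finset.abs_sum_le_sum_abs _ _).trans ?_
        exact hS q hq'.1.1 ⟨hq'.1.2.1.1, hq'.1.2.1.2, hq'.1.2.2⟩
    calc ∑ n ∈ Finset.Ioo q₁ q₂,
          ∑ q ∈ (I.filter (fun q => (q₁ < q.1 ∧ q.1 < q₂) ∧ (latSq (barlowPos a h s q.1 q.2.1 q.2.2) (barlowPos a h s q₁ i₀ j₀) ≤ ρ ^ 2))).filter (fun q => q.1 = n),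
            |∑ q' ∈ I.filter (fun q' => q'.1 = q.1 ∧ ¬ (latSq (barlowPos a h s q'.1 q'.2.1 q'.2.2) (barlowPos a h s q₁ i₀ j₀) ≤ ρ ^ 2)), Δ q q'|
        ≤ ∑ n ∈ Finset.Ioo q₁ q₂, 26 * (8 * 1 + 18) * A * ρ := Finset.sum_le_sum hlayer
      _ = (Finset.Ioo q₁ q₂).card * (676 * A * ρ) := by
          rw [Finset.sum_const, nsmul_eq_mul]; ring
      _ ≤ ((q₂ : ℝ) - q₁) * (676 * A * ρ) := by
          apply mul_le_mul_of_nonneg_right _ (by positivity)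
          rw [Int.card_Ioo]
          have : ((q₂ - q₁ - 1).toNat : ℝ) ≤ (q₂ : ℝ) - q₁ := by
            have h1 : ((q₂ - q₁ - 1).toNat : ℤ) ≤ q₂ - q₁ := by omega
            exact_mod_cast h1
          exact this
  rw [step1, step2, abs_mul, abs_two]
  nlinarith [step3]

/-! ## 5a. Lower sites outside the lateral disc -/

/-- **Rim across the cylinder wall, per cylinder point (L4).** There is `A ≥ 0` such that for
every cylinder point `q'` the lower sites `q` of the window OUTSIDE the lateral disc and at most `K`
layers below contribute `∑ |Δ q q'| ≤ A max(t - 1, 1/2)⁻³`, `t = ρ - √latSq(q')` the depth of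
`q'`: such a `q` is undisplaced and at lateral distance `> t` from `q'` (`≥ t - 3/5` from
`q' + σ w`), the `q`'s are `1/2`-separated, `|V| ≤ 6 r⁻⁶`, two-scale shell sum. [folklore] -/
theorem ledger_up_rim_site : ∃ A : ℝ, 0 ≤ A ∧ ∀ K : ℕ, 2 ≤ K →
    ∀ (a h : ℝ) (s : ℤ → ℤ) (q₁ q₂ i₀ j₀ : ℤ) (ρ R : ℝ) (I : Finset (ℤ × ℤ × ℤ))
      (D : ℤ × ℤ × ℤ → (EuclideanSpace ℝ (Fin 3))) (Δ : ℤ × ℤ × ℤ → ℤ × ℤ × ℤ → ℝ),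
      InBox a h → IsHaggSeq s → q₁ < q₂ → (3 : ℤ) ∣ haggLabel s q₂ - haggLabel s q₁ → 1 ≤ ρ →
      ρ + ((q₂ : ℝ) - q₁) * h + K * h + 1 ≤ R →
      (∀ q, InCyl a h s q₁ q₂ i₀ j₀ ρ q.1 q.2.1 q.2.2 →
        D q = ((shiftSign s q₁ q.1 : ℤ) : ℝ) • barlowOffset a) →
      (∀ q, ¬ InCyl a h s q₁ q₂ i₀ j₀ ρ q.1 q.2.1 q.2.2 → D q = 0) →
      (∀ q q', Δ q q' =
        lennardJones (dist (barlowPos a h s q.1 q.2.1 q.2.2 + D q)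
            (barlowPos a h s q'.1 q'.2.1 q'.2.2 + D q')) -
          lennardJones (dist (barlowPos a h s q.1 q.2.1 q.2.2)
            (barlowPos a h s q'.1 q'.2.1 q'.2.2))) →
      (∀ q, q ∈ I ↔ dist (barlowPos a h s q.1 q.2.1 q.2.2) (barlowPos a h s q₁ i₀ j₀) ≤ R) →
      ∀ q' ∈ I, (q₁ < q'.1 ∧ q'.1 < q₂ ∧ latSq (barlowPos a h s q'.1 q'.2.1 q'.2.2) (barlowPos a h s q₁ i₀ j₀) ≤ ρ ^ 2) →
        ∑ q ∈ I.filter (fun q => ¬ (latSq (barlowPos a h s q.1 q.2.1 q.2.2) (barlowPos a h s q₁ i₀ j₀) ≤ ρ ^ 2) ∧ (1 ≤ q'.1 - q.1 ∧ q'.1 - q.1 ≤ K)), |Δ q q'| ≤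
          A * (max (ρ - √(latSq (barlowPos a h s q'.1 q'.2.1 q'.2.2) (barlowPos a h s q₁ i₀ j₀)) - 1)
            (1 / 2))⁻¹ ^ 3 := by
  refine ⟨66000, by norm_num, ?_⟩
  intro K hK a h s q₁ q₂ i₀ j₀ ρ R I D Δ hbox hs hq hcharge hρ hR hD₁ hD₀ hΔ hI q' hqI hcyl
  classical
  have hρ0 : 0 ≤ ρ := by linarith
  have hsymm : ∀ q q', Δ q q' = Δ q' q := pairChange_symm hΔ
  have hcore := rim_sum_le K hK a h s q₁ q₂ i₀ j₀ ρ R I D Δ hbox hs hq hcharge hρ hR hD₁ hD₀ hΔ hI q'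
    (I.filter (fun q => ¬ (latSq (barlowPos a h s q.1 q.2.1 q.2.2) (barlowPos a h s q₁ i₀ j₀) ≤ ρ ^ 2) ∧ (1 ≤ q'.1 - q.1 ∧ q'.1 - q.1 ≤ K)))
    (ρ - √(latSq (barlowPos a h s q'.1 q'.2.1 q'.2.2) (barlowPos a h s q₁ i₀ j₀)))
    (fun h0 => (Finset.mem_filter.1 h0).2.1 hcyl.2.2) ?_
  · refine le_trans (Finset.sum_le_sum fun q _ => ?_) hcore
    rw [hsymm, hΔ]
    exact abs_sub _ _
  · intro q hq'
    rw [Finset.mem_filter] at hq'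
    have h1 : ρ < √(latSq (barlowPos a h s q.1 q.2.1 q.2.2) (barlowPos a h s q₁ i₀ j₀)) := by
      rw [← Real.sqrt_sq hρ0]
      exact Real.sqrt_lt_sqrt (sq_nonneg ρ) (not_le.1 hq'.2.1)
    have h2 := sqrt_latSq_triangle (barlowPos a h s q.1 q.2.1 q.2.2) (barlowPos a h s q'.1 q'.2.1 q'.2.2)
      (barlowPos a h s q₁ i₀ j₀)
    rw [latSq_comm (barlowPos a h s q.1 q.2.1 q.2.2) (barlowPos a h s q'.1 q'.2.1 q'.2.2)] at h2
    linarith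

/-- **Lower sites outside the lateral disc** (assembly of `ledger_up_rim_site` and
`ledger_depth_sum`): `∑_{q ∉ disc} |UP q| ≤ C₁ ρ (q₂ - q₁)`, `C₁ = 676 A` — an undisplaced lower
site only sees the cylinder points; swap the summations and sum the per-cylinder-point bound by
depth, layer by layer. [folklore] -/
theorem ledger_up_rim_out : ∃ C₁ : ℝ, 0 ≤ C₁ ∧ ∀ K : ℕ, 2 ≤ K →
    ∀ (a h : ℝ) (s : ℤ → ℤ) (q₁ q₂ i₀ j₀ : ℤ) (ρ R : ℝ) (I : Finset (ℤ × ℤ × ℤ))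
      (D : ℤ × ℤ × ℤ → (EuclideanSpace ℝ (Fin 3))) (Δ : ℤ × ℤ × ℤ → ℤ × ℤ × ℤ → ℝ),
      InBox a h → IsHaggSeq s → q₁ < q₂ → (3 : ℤ) ∣ haggLabel s q₂ - haggLabel s q₁ → 1 ≤ ρ →
      ρ + ((q₂ : ℝ) - q₁) * h + K * h + 1 ≤ R →
      (∀ q, InCyl a h s q₁ q₂ i₀ j₀ ρ q.1 q.2.1 q.2.2 →
        D q = ((shiftSign s q₁ q.1 : ℤ) : ℝ) • barlowOffset a) →
      (∀ q, ¬ InCyl a h s q₁ q₂ i₀ j₀ ρ q.1 q.2.1 q.2.2 → D q = 0) →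
      (∀ q q', Δ q q' =
        lennardJones (dist (barlowPos a h s q.1 q.2.1 q.2.2 + D q)
            (barlowPos a h s q'.1 q'.2.1 q'.2.2 + D q')) -
          lennardJones (dist (barlowPos a h s q.1 q.2.1 q.2.2)
            (barlowPos a h s q'.1 q'.2.1 q'.2.2))) →
      (∀ q, q ∈ I ↔ dist (barlowPos a h s q.1 q.2.1 q.2.2) (barlowPos a h s q₁ i₀ j₀) ≤ R) →
      ∑ q ∈ I.filter (fun q => ¬ (latSq (barlowPos a h s q.1 q.2.1 q.2.2) (barlowPos a h s q₁ i₀ j₀) ≤ ρ ^ 2)),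
          |∑ q' ∈ I.filter (fun q' => (1 ≤ q'.1 - q.1 ∧ q'.1 - q.1 ≤ K)), Δ q q'| ≤ C₁ * ρ * ((q₂ : ℝ) - q₁) := by
  obtain ⟨A, hA0, hsite⟩ := ledger_up_rim_site
  refine ⟨676 * A, by positivity, ?_⟩
  intro K hK a h s q₁ q₂ i₀ j₀ ρ R I D Δ hbox hs hq hcharge hρ hR hD₁ hD₀ hΔ hI
  classical
  have hS := hsite K hK a h s q₁ q₂ i₀ j₀ ρ R I D Δ hbox hs hq hcharge hρ hR hD₁ hD₀ hΔ hI
  have ha : 47 / 50 ≤ a := hbox.1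
  -- an undisplaced lower site only sees cylinder points
  have hvan : ∀ q q' : ℤ × ℤ × ℤ, ¬ (latSq (barlowPos a h s q.1 q.2.1 q.2.2) (barlowPos a h s q₁ i₀ j₀) ≤ ρ ^ 2) → ¬ (q₁ < q'.1 ∧ q'.1 < q₂ ∧ latSq (barlowPos a h s q'.1 q'.2.1 q'.2.2) (barlowPos a h s q₁ i₀ j₀) ≤ ρ ^ 2) → Δ q q' = 0 := by
    intro q q' hd hc'
    refine pairChange_eq_zero_of_disp_eq hΔ ?_
    rw [hD₀ q (fun hc => hd hc.2.2), hD₀ q' hc']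
  have step1 : ∑ q ∈ I.filter (fun q => ¬ (latSq (barlowPos a h s q.1 q.2.1 q.2.2) (barlowPos a h s q₁ i₀ j₀) ≤ ρ ^ 2)),
        |∑ q' ∈ I.filter (fun q' => (1 ≤ q'.1 - q.1 ∧ q'.1 - q.1 ≤ K)), Δ q q'| ≤
      ∑ q ∈ I, ∑ q' ∈ I,
        (if (¬ (latSq (barlowPos a h s q.1 q.2.1 q.2.2) (barlowPos a h s q₁ i₀ j₀) ≤ ρ ^ 2) ∧ (1 ≤ q'.1 - q.1 ∧ q'.1 - q.1 ≤ K)) ∧ (q₁ < q'.1 ∧ q'.1 < q₂ ∧ latSq (barlowPos a h s q'.1 q'.2.1 q'.2.2) (barlowPos a h s q₁ i₀ j₀) ≤ ρ ^ 2) then |Δ q q'| else 0) := by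
    rw [Finset.sum_filter]
    refine Finset.sum_le_sum fun q _ => ?_
    by_cases hd : (latSq (barlowPos a h s q.1 q.2.1 q.2.2) (barlowPos a h s q₁ i₀ j₀) ≤ ρ ^ 2)
    · rw [if_neg (fun h0 => h0 hd)]
      exact Finset.sum_nonneg fun q' _ => by split_ifs <;> simp
    · rw [if_pos hd]
      refine le_trans (Finset.abs_sum_le_sum_abs _ _) ?_
      rw [Finset.sum_filter]
      refine Finset.sum_le_sum fun q' _ => ?_
      by_cases hu : (1 ≤ q'.1 - q.1 ∧ q'.1 - q.1 ≤ K)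
      · rw [if_pos hu]
        by_cases hc' : (q₁ < q'.1 ∧ q'.1 < q₂ ∧ latSq (barlowPos a h s q'.1 q'.2.1 q'.2.2) (barlowPos a h s q₁ i₀ j₀) ≤ ρ ^ 2)
        · rw [if_pos ⟨⟨hd, hu⟩, hc'⟩]
        · rw [if_neg (fun h1 => hc' h1.2), hvan q q' hd hc', abs_zero]
      · rw [if_neg hu, if_neg (fun h1 => hu h1.1.2)]
  have step2 : ∑ q ∈ I, ∑ q' ∈ I,
        (if (¬ (latSq (barlowPos a h s q.1 q.2.1 q.2.2) (barlowPos a h s q₁ i₀ j₀) ≤ ρ ^ 2) ∧ (1 ≤ q'.1 - q.1 ∧ q'.1 - q.1 ≤ K)) ∧ (q₁ < q'.1 ∧ q'.1 < q₂ ∧ latSq (barlowPos a h s q'.1 q'.2.1 q'.2.2) (barlowPos a h s q₁ i₀ j₀) ≤ ρ ^ 2) then |Δ q q'| else 0) =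
      ∑ q' ∈ I.filter (fun q' => (q₁ < q'.1 ∧ q'.1 < q₂ ∧ latSq (barlowPos a h s q'.1 q'.2.1 q'.2.2) (barlowPos a h s q₁ i₀ j₀) ≤ ρ ^ 2)),
        ∑ q ∈ I.filter (fun q => ¬ (latSq (barlowPos a h s q.1 q.2.1 q.2.2) (barlowPos a h s q₁ i₀ j₀) ≤ ρ ^ 2) ∧ (1 ≤ q'.1 - q.1 ∧ q'.1 - q.1 ≤ K)), |Δ q q'| := by
    rw [Finset.sum_comm, Finset.sum_filter]
    refine Finset.sum_congr rfl fun q' _ => ?_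
    rw [Finset.sum_filter]
    split_ifs with hc'
    · exact Finset.sum_congr rfl fun q _ => by simp only [hc', and_true]
    · exact Finset.sum_eq_zero fun q _ => if_neg (fun h1 => hc' h1.2)
  have step3 : ∑ q' ∈ I.filter (fun q' => (q₁ < q'.1 ∧ q'.1 < q₂ ∧ latSq (barlowPos a h s q'.1 q'.2.1 q'.2.2) (barlowPos a h s q₁ i₀ j₀) ≤ ρ ^ 2)),
        ∑ q ∈ I.filter (fun q => ¬ (latSq (barlowPos a h s q.1 q.2.1 q.2.2) (barlowPos a h s q₁ i₀ j₀) ≤ ρ ^ 2) ∧ (1 ≤ q'.1 - q.1 ∧ q'.1 - q.1 ≤ K)), |Δ q q'| ≤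
      ((q₂ : ℝ) - q₁) * (676 * A * ρ) := by
    have hmaps : ∀ q' ∈ I.filter (fun q' => (q₁ < q'.1 ∧ q'.1 < q₂ ∧ latSq (barlowPos a h s q'.1 q'.2.1 q'.2.2) (barlowPos a h s q₁ i₀ j₀) ≤ ρ ^ 2)), q'.1 ∈ Finset.Ioo q₁ q₂ := by
      intro q' hq'
      rw [Finset.mem_filter] at hq'
      exact Finset.mem_Ioo.2 ⟨hq'.2.1, hq'.2.2.1⟩
    rw [← Finset.sum_fiberwise_of_maps_to hmaps]
    have hlayer : ∀ n ∈ Finset.Ioo q₁ q₂,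
        ∑ q' ∈ (I.filter (fun q' => (q₁ < q'.1 ∧ q'.1 < q₂ ∧ latSq (barlowPos a h s q'.1 q'.2.1 q'.2.2) (barlowPos a h s q₁ i₀ j₀) ≤ ρ ^ 2))).filter (fun q' => q'.1 = n),
          ∑ q ∈ I.filter (fun q => ¬ (latSq (barlowPos a h s q.1 q.2.1 q.2.2) (barlowPos a h s q₁ i₀ j₀) ≤ ρ ^ 2) ∧ (1 ≤ q'.1 - q.1 ∧ q'.1 - q.1 ≤ K)), |Δ q q'| ≤
          26 * (8 * 1 + 18) * A * ρ := by
      intro n hn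
      refine ledger_depth_sum a h s q₁ i₀ j₀ ρ n 1 A _ _ ha hρ zero_le_one hA0 ?_ ?_
      · intro q' hq'
        simp only [Finset.mem_filter] at hq'
        exact ⟨hq'.2, hq'.1.2.2.2⟩
      · intro q' hq'
        simp only [Finset.mem_filter] at hq'
        exact hS q' hq'.1.1 hq'.1.2
    calc ∑ n ∈ Finset.Ioo q₁ q₂,
          ∑ q' ∈ (I.filter (fun q' => (q₁ < q'.1 ∧ q'.1 < q₂ ∧ latSq (barlowPos a h s q'.1 q'.2.1 q'.2.2) (barlowPos a h s q₁ i₀ j₀) ≤ ρ ^ 2))).filter (fun q' => q'.1 = n),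
            ∑ q ∈ I.filter (fun q => ¬ (latSq (barlowPos a h s q.1 q.2.1 q.2.2) (barlowPos a h s q₁ i₀ j₀) ≤ ρ ^ 2) ∧ (1 ≤ q'.1 - q.1 ∧ q'.1 - q.1 ≤ K)), |Δ q q'|
        ≤ ∑ n ∈ Finset.Ioo q₁ q₂, 26 * (8 * 1 + 18) * A * ρ := Finset.sum_le_sum hlayer
      _ = (Finset.Ioo q₁ q₂).card * (676 * A * ρ) := by
          rw [Finset.sum_const, nsmul_eq_mul]; ring
      _ ≤ ((q₂ : ℝ) - q₁) * (676 * A * ρ) := by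
          apply mul_le_mul_of_nonneg_right _ (by positivity)
          rw [Int.card_Ioo]
          have h1 : ((q₂ - q₁ - 1).toNat : ℤ) ≤ q₂ - q₁ := by omega
          exact_mod_cast h1
  calc _ ≤ _ := step1
    _ = _ := step2
    _ ≤ ((q₂ : ℝ) - q₁) * (676 * A * ρ) := step3
    _ = 676 * A * ρ * ((q₂ : ℝ) - q₁) := by ring

end Summit.AtomisticToContinuum.Crystallization.Theorems.SquareWellLayerCake.StackingFaultSparsity

end
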